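import Summits.Ventures.LatticeQCDFlow.Scaling.DominatedStarAugmentation
import Literature.Probability.MarkovChains.MarkovianCoupling

/-!
HONEST FRAMING: exact (Metropolis-corrected) sampling algorithms for lattice gauge theory; figures
of merit are autocorrelation/cost numbers at stated couplings and volumes; no continuum-physics
claim.

# BooleanStarCoupling — THE BOOLEAN STAR IS ATTRACTIVE: THE SYNCHRONOUS COUPLING (COMMON ENTRY, COMMON ACCEPTANCE UNIFORM, COMMON
# HOT DRAW, COMMON COLD MOVE AT AGREEING LEVELS) IS A MARKOVIAN COUPLING OF THE MAP-ASSISTED HOT-REFRESHED HUB ON TWO-POINT REPLICAS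
# (lean-2 GEN-30, ours)

Venture-side (OURS).  Cell `lqcd-flow` (pub-lqcd), unit `pub-lqcd-lean-2-g30`, 2026-08-28.  Chapter P (OPEN-MATH-chapterM item 1 on
the two-point family), file 1.  THE BOOLEAN STAR: the scheme `P = t·GSw + (1−t)·Π_w^M` of chapters J–O (hub list `e_r = (0, κ_r+1)`,
Metropolis graph swap `GSw`, single-site updates `M_k` with weights `w`) on TWO-POINT replicas `S = Bool` with IDENTITY entry maps, the
EXACT hot sampler `M_0(u,·) = μ_0` and arbitrary row-stochastic cold kernels; chapter O's witness (`μ_k = (θ,1−θ)`, `μ_0 = (pθ,1−pθ)`, idle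
cold replicas) is the instance on which the floors with the map quality were computed.  THE SYNCHRONOUS COUPLING `Q` of two copies
`(x,y)`: the same entry `r` is drawn for both; the two accept/reject decisions use ONE uniform, so both copies move with probability
`min{α_r(x), α_r(y)}`, only the likelier one with the excess `|α_r(x) − α_r(y)|`, neither with `1 − max`; the same update level `k` is drawn;
the hot redraw hands both copies the SAME fresh value; a cold move at a level where the copies agree is common, at a disagreeing cold
level the two copies move independently.  Everything is carried as hypothesis-equations (`hα`, `hQ`); no definitions.

## What is proved

* §1 `sum_ite_and_right` ∕ `_left` (pair indicators), `coordKernel_eq_sum_ite` (the single-site kernel as point masses),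
  `sum_coordKernel_eq_one`.
* §2 the rows of `Q`: `syncSwap_sum_right` ∕ `_left` (the four outcomes of an entry sum to the accept/reject form of EACH copy),
  `syncUpdate_sum_right` ∕ `_left` (the update part moves each copy by `P̃_k`; the left marginal uses `M_0(u,·) = μ_0`),
  `syncSwap_weights_nonneg` (`1 − α_x − α_y + min ≥ 0`).
* §3 **`boolSync_isMarkovianCoupling`** — `Q` is a Markovian coupling of `t·GSw + (1−t)·Π_w^M` (LPW §5.1, in the tree:
  `Literature/Probability/MarkovChains/MarkovianCoupling`): `m ≥ 1`, `0 ≤ t ≤ 1`, `w ≥ 0`, `μ > 0`, `M_k` row-stochastic, `M_0` exact.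

Reading (no numerics implied): this is the coupling under which the number of disagreeing replicas never increases (file 2) and
contracts geometrically (files 3–4): the persistent hub on two points is a monotone system.  NOT CLAIMED: non-identity entry maps (an
entry mapped by `¬` turns the swap into a two-site flip — another Boolean model, untyped); general `S` (the sector projection of the
chapter-O scheme is Markov only on two points).  Literature grade (cell rule): OWN CONSTRUCTION on a textbook notion (Markovian
coupling, LPW §5.1, cited through the tree file); nothing cited as a fact; no new bib keys.
-/

noncomputable section

open Finset Function
open Literature.Probability.MarkovChains

namespace Summit.Ventures.LatticeQCDFlow.Scaling

variable {K m : ℕ} {μ : Fin (K + 1) → Bool → ℝ} {M : Fin (K + 1) → Bool → Bool → ℝ} {w : Fin (K + 1) → ℝ} {t : ℝ}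

section Coupling
variable (κ : Fin m → Fin K)

/-! ## §1 Indicator bookkeeping -/

/-- `Σ_b 𝟙{a = a' ∧ b = b'} = 𝟙{a = a'}`. [ours] -/
theorem sum_ite_and_right {α β : Type*} [Fintype β] [DecidableEq α] [DecidableEq β] (a a' : α) (b' : β) :
    ∑ b : β, (if a = a' ∧ b = b' then (1 : ℝ) else 0) = if a = a' then (1 : ℝ) else 0 := by
  by_cases h : a = a'
  · simp only [h, true_and, if_true]; rw [Finset.sum_ite_eq' univ b', if_pos (mem_univ _)]
  · rw [if_neg h]; exact sum_eq_zero fun b _ => if_neg fun h' => h h'.1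

/-- `Σ_a 𝟙{a = a' ∧ b = b'} = 𝟙{b = b'}`. [ours] -/
theorem sum_ite_and_left {α β : Type*} [Fintype α] [DecidableEq α] [DecidableEq β] (a' : α) (b b' : β) :
    ∑ a : α, (if a = a' ∧ b = b' then (1 : ℝ) else 0) = if b = b' then (1 : ℝ) else 0 := by
  by_cases h : b = b'
  · simp only [h, and_true, if_true]; rw [Finset.sum_ite_eq' univ a', if_pos (mem_univ _)]
  · rw [if_neg h]; exact sum_eq_zero fun a _ => if_neg fun h' => h h'.2

/-- The single-coordinate kernel as a sum of point masses: `P̃_k(x,z) = Σ_v M_k(x_k,v)·𝟙{z = x[k ↦ v]}`. [ours] -/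
theorem coordKernel_eq_sum_ite (k : Fin (K + 1)) (x z : Fin (K + 1) → Bool) :
    coordKernel M k x z = ∑ v : Bool, M k (x k) v * (if z = update x k v then (1 : ℝ) else 0) := by
  unfold coordKernel
  by_cases h : z = update x k (z k)
  · rw [if_pos h, Finset.sum_eq_single (z k)]
    · rw [if_pos h, mul_one]
    · intro v _ hv
      rw [if_neg, mul_zero]
      intro h'
      apply hv
      have := congrFun h' k
      rw [update_self] at this
      exact this.symm
    · intro h'; exact absurd (mem_univ _) h'
  · rw [if_neg h]
    symm
    refine sum_eq_zero fun v _ => ?_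
    rw [if_neg, mul_zero]
    intro h'
    apply h
    have hv : z k = v := by have := congrFun h' k; rw [update_self] at this; exact this
    rw [hv]; exact h'

/-- The single-coordinate kernel has unit row sums (`M_k` row-stochastic). [ours] -/
theorem sum_coordKernel_eq_one (hM : ∀ k, IsRowStochastic (M k)) (k : Fin (K + 1)) (x : Fin (K + 1) → Bool) :
    ∑ z, coordKernel M k x z = 1 := by
  have h := sum_coordKernel_mul M k x (fun _ => (1 : ℝ))
  simp only [mul_one] at h
  rw [h, (hM k).2]

/-! ## §2 The synchronous coupling: rows -/

/-- **Right marginal of the swap part, entry by entry:** the four outcomes of the common-uniform coupling of the two accept/reject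
decisions sum, over the second coordinate, to `α_r(x)·𝟙{x' = y_r x} + (1 − α_r(x))·𝟙{x' = x}`. [ours] -/
theorem syncSwap_sum_right (αx αy : ℝ) (x y yx yy x' : Fin (K + 1) → Bool) :
    ∑ y' : Fin (K + 1) → Bool,
        (min αx αy * (if x' = yx ∧ y' = yy then (1 : ℝ) else 0)
          + (αx - min αx αy) * (if x' = yx ∧ y' = y then (1 : ℝ) else 0)
          + (αy - min αx αy) * (if x' = x ∧ y' = yy then (1 : ℝ) else 0)
          + (1 - αx - αy + min αx αy) * (if x' = x ∧ y' = y then (1 : ℝ) else 0))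
      = αx * (if x' = yx then (1 : ℝ) else 0) + (1 - αx) * (if x' = x then (1 : ℝ) else 0) := by
  rw [Finset.sum_add_distrib, Finset.sum_add_distrib, Finset.sum_add_distrib, ← Finset.mul_sum, ← Finset.mul_sum,
    ← Finset.mul_sum, ← Finset.mul_sum, sum_ite_and_right, sum_ite_and_right, sum_ite_and_right, sum_ite_and_right]
  ring

/-- **Left marginal of the swap part, entry by entry.** [ours] -/
theorem syncSwap_sum_left (αx αy : ℝ) (x y yx yy y' : Fin (K + 1) → Bool) :
    ∑ x' : Fin (K + 1) → Bool,
        (min αx αy * (if x' = yx ∧ y' = yy then (1 : ℝ) else 0)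
          + (αx - min αx αy) * (if x' = yx ∧ y' = y then (1 : ℝ) else 0)
          + (αy - min αx αy) * (if x' = x ∧ y' = yy then (1 : ℝ) else 0)
          + (1 - αx - αy + min αx αy) * (if x' = x ∧ y' = y then (1 : ℝ) else 0))
      = αy * (if y' = yy then (1 : ℝ) else 0) + (1 - αy) * (if y' = y then (1 : ℝ) else 0) := by
  rw [Finset.sum_add_distrib, Finset.sum_add_distrib, Finset.sum_add_distrib, ← Finset.mul_sum, ← Finset.mul_sum,
    ← Finset.mul_sum, ← Finset.mul_sum, sum_ite_and_left, sum_ite_and_left, sum_ite_and_left, sum_ite_and_left]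
  ring

/-- **Right marginal of the update part, level by level:** common move at an agreeing level or at the hot level (exact redraw),
independent moves at a disagreeing cold level — either way the first copy moves by `P̃_k`. [ours] -/
theorem syncUpdate_sum_right (hM : ∀ k, IsRowStochastic (M k)) (k : Fin (K + 1)) (x y x' : Fin (K + 1) → Bool) :
    ∑ y' : Fin (K + 1) → Bool,
        (if x k = y k ∨ k = 0 then
            ∑ v : Bool, M k (x k) v * (if x' = update x k v ∧ y' = update y k v then (1 : ℝ) else 0)
          else coordKernel M k x x' * coordKernel M k y y')
      = coordKernel M k x x' := by
  by_cases h : x k = y k ∨ k = 0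
  · simp only [h, if_true]
    rw [Finset.sum_comm]
    simp_rw [← Finset.mul_sum, sum_ite_and_right]
    rw [coordKernel_eq_sum_ite]
  · simp only [h, if_false]
    rw [← Finset.mul_sum, sum_coordKernel_eq_one hM, mul_one]

/-- **Left marginal of the update part, level by level** (the hot kernel is the exact redraw `M_0(u,·) = μ_0`, so the common hot
move is a move of the second copy too). [ours] -/
theorem syncUpdate_sum_left (hM : ∀ k, IsRowStochastic (M k)) (hM0 : ∀ u v, M 0 u v = μ 0 v) (k : Fin (K + 1))
    (x y y' : Fin (K + 1) → Bool) :
    ∑ x' : Fin (K + 1) → Bool,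
        (if x k = y k ∨ k = 0 then
            ∑ v : Bool, M k (x k) v * (if x' = update x k v ∧ y' = update y k v then (1 : ℝ) else 0)
          else coordKernel M k x x' * coordKernel M k y y')
      = coordKernel M k y y' := by
  by_cases h : x k = y k ∨ k = 0
  · simp only [h, if_true]
    rw [Finset.sum_comm]
    simp_rw [← Finset.mul_sum, sum_ite_and_left]
    rw [coordKernel_eq_sum_ite]
    refine sum_congr rfl fun v _ => ?_
    rcases h with h | h
    · rw [h]
    · subst h; rw [hM0, hM0]
  · simp only [h, if_false]
    rw [← Finset.sum_mul, sum_coordKernel_eq_one hM, one_mul]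

/-- The four coupling weights of an entry are non-negative (`0 ≤ α ≤ 1`). [ours] -/
theorem syncSwap_weights_nonneg {αx αy : ℝ} (h0x : 0 ≤ αx) (h1x : αx ≤ 1) (h0y : 0 ≤ αy) (h1y : αy ≤ 1) :
    0 ≤ min αx αy ∧ 0 ≤ αx - min αx αy ∧ 0 ≤ αy - min αx αy ∧ 0 ≤ 1 - αx - αy + min αx αy := by
  refine ⟨le_min h0x h0y, sub_nonneg.mpr (min_le_left _ _), sub_nonneg.mpr (min_le_right _ _), ?_⟩
  rcases le_total αx αy with h | h
  · rw [min_eq_left h]; linarith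
  · rw [min_eq_right h]; linarith

/-! ## §3 The synchronous coupling is a Markovian coupling of the scheme -/

/-- **THE SYNCHRONOUS COUPLING OF THE BOOLEAN STAR IS A MARKOVIAN COUPLING OF `t·GSw + (1−t)·Π_w^M`** (two-point replicas,
identity entry maps on the hub list `κ`, exact hot redraws, arbitrary row-stochastic cold kernels; `m ≥ 1`, `0 ≤ t ≤ 1`, `w ≥ 0`):
common entry, common acceptance uniform (both copies move with probability `min{α_r(x), α_r(y)}`, only the likelier one with the
excess), common hot draw, common cold move at agreeing levels, independent cold moves at disagreeing levels. [ours] -/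
theorem boolSync_isMarkovianCoupling (hm : 1 ≤ m) (ht0 : 0 ≤ t) (ht1 : t ≤ 1) (hw0 : ∀ k, 0 ≤ w k)
    (hμ : ∀ k x, 0 < μ k x) (hM : ∀ k, IsRowStochastic (M k)) (hM0 : ∀ u v, M 0 u v = μ 0 v)
    {α : Fin m → (Fin (K + 1) → Bool) → ℝ}
    (hα : ∀ r z, α r z = min 1 (tensorFun μ (edgeFlowSwap (Equiv.refl Bool) 0 (κ r).succ z) / tensorFun μ z))
    {Q : (Fin (K + 1) → Bool) × (Fin (K + 1) → Bool) → (Fin (K + 1) → Bool) × (Fin (K + 1) → Bool) → ℝ}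
    (hQ : ∀ a b, Q a b =
      ∑ r : Fin m, t / m *
        (min (α r a.1) (α r a.2) * (if b.1 = edgeFlowSwap (Equiv.refl Bool) 0 (κ r).succ a.1
              ∧ b.2 = edgeFlowSwap (Equiv.refl Bool) 0 (κ r).succ a.2 then (1 : ℝ) else 0)
          + (α r a.1 - min (α r a.1) (α r a.2)) * (if b.1 = edgeFlowSwap (Equiv.refl Bool) 0 (κ r).succ a.1 ∧ b.2 = a.2
              then (1 : ℝ) else 0)
          + (α r a.2 - min (α r a.1) (α r a.2)) * (if b.1 = a.1 ∧ b.2 = edgeFlowSwap (Equiv.refl Bool) 0 (κ r).succ a.2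
              then (1 : ℝ) else 0)
          + (1 - α r a.1 - α r a.2 + min (α r a.1) (α r a.2)) * (if b.1 = a.1 ∧ b.2 = a.2 then (1 : ℝ) else 0))
      + (1 - t) * ∑ k : Fin (K + 1), w k *
        (if a.1 k = a.2 k ∨ k = 0 then
            ∑ v : Bool, M k (a.1 k) v * (if b.1 = update a.1 k v ∧ b.2 = update a.2 k v then (1 : ℝ) else 0)
          else coordKernel M k a.1 b.1 * coordKernel M k a.2 b.2)) :
    IsMarkovianCoupling (fun y z : Fin (K + 1) → Bool =>
        t * ptGraphSwap μ (fun r : Fin m => (((0 : Fin (K + 1)), (κ r).succ) : Fin (K + 1) × Fin (K + 1)))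
              (fun _ : Fin m => Equiv.refl Bool) y z
          + (1 - t) * prodKernel w M y z) Q := by
  have hmpos : (0 : ℝ) < m := Nat.cast_pos.mpr (by omega)
  have he := hubList_fst_ne_snd (K := K) κ
  have hacc := accept_mem κ (fun _ : Fin m => Equiv.refl Bool) hμ hα
  -- the scheme, entry by entry, in accept/reject form
  have hP : ∀ y z : Fin (K + 1) → Bool,
      t * ptGraphSwap μ (fun r : Fin m => (((0 : Fin (K + 1)), (κ r).succ) : Fin (K + 1) × Fin (K + 1)))
            (fun _ : Fin m => Equiv.refl Bool) y z + (1 - t) * prodKernel w M y z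
        = ∑ r : Fin m, t / m * (α r y * (if z = edgeFlowSwap (Equiv.refl Bool) 0 (κ r).succ y then (1 : ℝ) else 0)
            + (1 - α r y) * (if z = y then (1 : ℝ) else 0))
          + (1 - t) * ∑ k : Fin (K + 1), w k * coordKernel M k y z := by
    intro y z
    rw [ptGraphSwap_eq_avg_entryKernel (φ := fun _ : Fin m => Equiv.refl Bool) hm he hμ, prodKernel_apply, Finset.mul_sum]
    congr 1
    refine sum_congr rfl fun r _ => ?_
    rw [entrySwap_eq_accept_reject κ (fun _ : Fin m => Equiv.refl Bool) hμ hα r y z]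
    ring
  intro x y
  refine ⟨fun a b => ?_, fun a => ?_, fun b => ?_⟩
  · -- non-negativity
    show 0 ≤ Q (x, y) (a, b)
    rw [hQ]
    refine add_nonneg (sum_nonneg fun r _ => mul_nonneg (by positivity) ?_)
      (mul_nonneg (by linarith) (sum_nonneg fun k _ => mul_nonneg (hw0 k) ?_))
    · obtain ⟨h1, h2, h3, h4⟩ := syncSwap_weights_nonneg (hacc r x).1 (hacc r x).2 (hacc r y).1 (hacc r y).2
      refine add_nonneg (add_nonneg (add_nonneg ?_ ?_) ?_) ?_
      · exact mul_nonneg h1 (by split_ifs <;> norm_num)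
      · exact mul_nonneg h2 (by split_ifs <;> norm_num)
      · exact mul_nonneg h3 (by split_ifs <;> norm_num)
      · exact mul_nonneg h4 (by split_ifs <;> norm_num)
    · split_ifs
      · exact sum_nonneg fun v _ => mul_nonneg ((hM k).1 _ _) (by split_ifs <;> norm_num)
      · exact mul_nonneg (coordKernel_nonneg M (fun j u v => (hM j).1 u v) k _ _)
          (coordKernel_nonneg M (fun j u v => (hM j).1 u v) k _ _)
  · -- right marginal: the first copy moves by the scheme
    show ∑ b, Q (x, y) (a, b) = _
    simp_rw [hQ]
    rw [Finset.sum_add_distrib, ← Finset.sum_comm, ← Finset.mul_sum, hP]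
    congr 1
    · refine sum_congr rfl fun r _ => ?_
      rw [← Finset.mul_sum, syncSwap_sum_right]
    · congr 1
      rw [Finset.sum_comm]
      refine sum_congr rfl fun k _ => ?_
      rw [← Finset.mul_sum, syncUpdate_sum_right hM]
  · -- left marginal: the second copy moves by the scheme
    show ∑ a, Q (x, y) (a, b) = _
    simp_rw [hQ]
    rw [Finset.sum_add_distrib, ← Finset.sum_comm, ← Finset.mul_sum, hP]
    congr 1
    · refine sum_congr rfl fun r _ => ?_
      rw [← Finset.mul_sum, syncSwap_sum_left]
    · congr 1
      rw [Finset.sum_comm]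
      refine sum_congr rfl fun k _ => ?_
      rw [← Finset.mul_sum, syncUpdate_sum_left hM hM0]

end Coupling

end Summit.Ventures.LatticeQCDFlow.Scaling

end
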